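import Summits.QuantumAdvantage.QuantumAdvantage.Theorems.CubicForrelationNearExactIsExactTwelveLevelSixOffFlat216
import Summits.QuantumAdvantage.QuantumAdvantage.Theorems.CubicForrelationNearExactIsExactTwelveLevelSixH34RigidW2
import Summits.QuantumAdvantage.QuantumAdvantage.Theorems.CubicForrelationNearExactIsExactTwelveLevelSixDualKill9
import Summits.QuantumAdvantage.QuantumAdvantage.Theorems.CubicForrelationNearExactIsExactTwelveLevelSixEight735
import Summits.QuantumAdvantage.QuantumAdvantage.Theorems.CubicForrelationNearExactIsExactKtGapTwoCubic
import Summits.QuantumAdvantage.QuantumAdvantage.Theorems.CubicForrelationNearExactIsExactTwelveClosed934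

/-!
# Crux `CubicForrelation.NearExactIsExact` (stmt-QuantumAdvantage-14043) — n = 12: the value `933/1024` is NOT attained;
  `Φ ≥ 933/1024 ⇒ Φ = 1` (closed), `θ₁₂ ∈ [57/64, 933/1024)`

Certificate seat `b2b-cforr-cert` (gen 18).  HONEST FRAMING: a kernel-checked DECIDABLE VERDICT (standard axioms, no `decide`/`native_decide`)
about the finite slice `n = 12` of the crux — NOT summit progress (the crux asks for ONE `θ < 1` uniform in `n`; nothing here is uniform).
The tree had `θ₁₂ ∈ [57/64, 934/1024)` (gen 18, `…TwelveClosed934`).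

PART 1 — `tw18_levelSix_933_false`: no level-`≥ 6` side (`W_g ∈ 64ℤ`) for `933/1024 ≤ Φ < 59/64`.  `Σ e² = 8192(1 − Φ) ≤ 728`; all `u''` odd
makes `g` bent; otherwise `Z = {u'' even}` is a 9-flat and the off-flat energy is `≤ 216`.  The PARTNER `f` is at level `≥ 6` (type O excluded
by the second Kasami–Tokura gap `to18_typeO_gt932_false`, level 5 by `tw15_levelFive_932_false`, for `(g, f)`).  `tw18_off_flat_le216` splits:
(i) `8 ∣ e` off `Z`: `tw18_levelSix_eight_partner_false735` (budget `728`); (ii) sparse two-coset, `≤ 31` bad points per coset, `Σ_Z (e² − 1) ≤ 88`: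
(H3)/(H4) by avoidance, no mild wild point, `e² ∈ {1, 49, 81}` on `Z`, two-sided kill `tw18_levelSix_sparse9_false` (`3·216 + 4·88 < 1440`);
(iii) RIGID (`≤ 54` exceptional points, `e = ±2` at all but at most TWO of them, energy `≥ 192`, `Σ_Z (e² − 1) ≤ 24`): (H3)/(H4) by WEIGHTED
few-hit transversal directions (`tw18_H34_rigid_w2`, weight `2` on the two exceptional points), no mild wild point, so `e² = 1` on `Z`, then
`tw16_levelSix_sparse7_false` (`3·216 + 96 < 1440`).
PART 2 — the window: type O (`to18_typeO_gt932_false`: NO type-O side above `932/1024`, by the classification-free second Kasami–Tokura gap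
`kt_gap2_twelve` — no cubic on 12 bits has weight in `(896, 960)`), level 5 (`tw15_levelFive_932_false`), level `≥ 6` (Part 1).  Hence
`tw18_window_933_false`, `isolation_twelve_ge_933` (`Φ ≥ 933/1024 ⇒ Φ = 1` at `Fin 12`), `theta_twelve_halfopen_933`
(`θ₁₂ ∈ [57/64, 933/1024) = [912/1024, 933/1024)`), `no_window_twelve_ge_933`.  Open at `n = 12`: the 20 values `913/1024 … 932/1024`; from
`932/1024` down the level-5 branch (`tw15_levelFive_932_false`) must be reopened.

References: Ax (1964) / McEliece (1972); Kasami–Tokura (1970); Hou (1998); MacWilliams–Sloane (1977) Ch. 13–15; Carlet (2021) §5.2;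
O'Donnell (2014) §3.3.  Everything below is proved from Mathlib and the tree; axioms are the standard three.
-/

set_option linter.dupNamespace false -- D-0017: single-problem summit ⇒ `QuantumAdvantage.QuantumAdvantage` by design

noncomputable section

namespace Summit.QuantumAdvantage.QuantumAdvantage.Theorems.CubicForrelation.NearExactIsExact

open Finset
open Literature.Computability.QuantumComplexity
open Literature.Computability.QuantumComplexity.BuzetChailloux (bxor zeroVec bxor_bxor_cancel_left bxor_zeroVec zeroVec_bxor bxor_comm
  bxor_self)
open Literature.Computability.QuantumComplexity.DerivativeWalsh (W)

/-! ### Part 1: no level-`≥ 6` side on `[933/1024, 59/64)` -/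

/-- **A level-`≥ 6` side is impossible for `933/1024 ≤ Φ < 59/64` on 12 bits.**  Cubic `f, g : 𝔽₂¹² → 𝔽₂` with `W_g = 64·u''` and
`933/1024 ≤ Φ(f,g) < 59/64` cannot exist.  Finite-slice statement; NOT summit progress. [this work] -/
theorem tw18_levelSix_933_false (f g : (Fin (6 + 6) → Bool) → Bool) (hf : IsDegLeFun 3 f) (hg : IsDegLeFun 3 g)
    (u'' : (Fin (6 + 6) → Bool) → ℤ) (hu'' : ∀ x, W (fun y => signOf (g y)) x = (2 : ℝ) ^ 6 * (u'' x : ℝ))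
    (hlo : (933 / 1024 : ℝ) ≤ forrelation f g) (hhi : forrelation f g < 59 / 64) : False := by
  classical
  -- `u = 4u''` at the Ax level `4`
  set u : (Fin (6 + 6) → Bool) → ℤ := fun x => 4 * u'' x with hudef
  have hu : ∀ x, W (fun y => signOf (g y)) x = (2 : ℝ) ^ 4 * (u x : ℝ) := by
    intro x; rw [hu'' x]; simp only [u]; push_cast; ring
  -- the residual `e = u'' − s` and its budget `B = Σ e² = 8192(1 − Φ) ≤ 728`
  set e : (Fin (6 + 6) → Bool) → ℤ := fun x => u'' x - sZ (f x) with hedef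
  have hFe : ∀ y, u y - 4 * sZ (f y) = 4 * e y := fun y => by simp only [u, e]; ring
  have hbud := tw12_budget f g u hu
  have h16 : ∀ x, (u x - 4 * sZ (f x)) ^ 2 = 16 * e x ^ 2 := fun x => by rw [hFe]; ring
  have hBR : ((∑ x, e x ^ 2 : ℤ) : ℝ) = 8192 * (1 - forrelation f g) := by
    have h' : ((∑ x, (u x - 4 * sZ (f x)) ^ 2 : ℤ) : ℝ) = 16 * ((∑ x, e x ^ 2 : ℤ) : ℝ) := by
      rw [sum_congr rfl fun x _ => h16 x, ← mul_sum]; push_cast; ring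
    rw [h'] at hbud
    linarith
  have hB_le : (∑ x, e x ^ 2 : ℤ) ≤ 728 := by
    have h' : ((∑ x, e x ^ 2 : ℤ) : ℝ) ≤ 728 := by rw [hBR]; linarith
    exact_mod_cast h'
  -- even points of `u''` cost `≥ 1`
  set Z := univ.filter (fun x : Fin (6 + 6) → Bool => ¬ Odd (u'' x)) with hZdef
  have hmemZ : ∀ x, x ∈ Z ↔ ¬ Odd (u'' x) := fun x => by simp [hZdef]
  have heodd : ∀ x, x ∈ Z → Odd (e x) := by
    intro x hx
    have hev := Int.not_odd_iff_even.1 ((hmemZ x).1 hx)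
    rcases tp_sZ_cases (f x) with hs | hs <;> simp only [e] <;> rw [hs]
    · exact Int.odd_sub.2 (iff_of_false (Int.not_odd_iff_even.2 hev) (by decide))
    · exact Int.odd_sub.2 (iff_of_false (Int.not_odd_iff_even.2 hev) (by decide))
  have hsq1 : ∀ x, x ∈ Z → 1 ≤ e x ^ 2 := by
    intro x hx
    have h0 := Int.odd_iff.1 (heodd x hx)
    have : e x ≤ -1 ∨ 1 ≤ e x := by omega
    have := tp_sq_ge (k := 1) (by norm_num) this
    linarith
  have hsplit : (∑ x, e x ^ 2 : ℤ) = ∑ x ∈ Z, e x ^ 2 + ∑ x ∈ univ.filter (fun x => x ∉ Z), e x ^ 2 := by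
    rw [← sum_filter_add_sum_filter_not univ (fun x => x ∈ Z)]
    congr 1
    exact sum_congr (by ext x; simp) fun _ _ => rfl
  have hZle : (#Z : ℤ) ≤ 728 := by
    have h2 : ∑ x ∈ Z, (1 : ℤ) ≤ ∑ x ∈ Z, e x ^ 2 := sum_le_sum fun x hx => hsq1 x hx
    rw [sum_const, nsmul_eq_mul, mul_one] at h2
    linarith [sum_nonneg fun x (_ : x ∈ univ.filter (fun x => x ∉ Z)) => sq_nonneg (e x)]
  -- Parseval at level 6: `Σ u''² = 4096`
  have hpar : ∑ x, u'' x ^ 2 = 4096 := by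
    have h := zms_sum_u_sq 2 g u (fun x => (hu x).trans (by norm_num))
    have e : ∑ x, ((u x : ℝ)) ^ 2 = 16 * ∑ x, ((u'' x : ℝ)) ^ 2 := by
      rw [mul_sum]; exact sum_congr rfl fun x _ => by simp only [u]; push_cast; ring
    rw [e] at h
    norm_num at h
    have h' : ∑ x, ((u'' x : ℝ)) ^ 2 = 4096 := by linarith
    exact_mod_cast h'
  by_cases hall : ∀ x, Odd (u'' x)
  · -- every `u''` odd: `g` is bent, `Φ = 1` or `Φ ≤ 7/8`
    have hsq1' : ∀ x, u'' x ^ 2 = 1 := by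
      have hge : ∀ x, (1 : ℤ) ≤ u'' x ^ 2 := fun x => by
        have h0 := Int.odd_iff.1 (hall x)
        have : u'' x ≤ -1 ∨ 1 ≤ u'' x := by omega
        have := tp_sq_ge (k := 1) (by norm_num) this
        linarith
      have hsum0 : ∑ x, (u'' x ^ 2 - 1 : ℤ) = 0 := by
        rw [sum_sub_distrib, hpar, sum_const, card_univ, Fintype.card_fun, Fintype.card_bool, Fintype.card_fin]; norm_num
      intro x
      have := (sum_eq_zero_iff_of_nonneg fun y _ => by have := hge y; linarith).1 hsum0 x (mem_univ x)
      linarith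
    have hbent : ∀ x, W (fun y => signOf (g y)) x ^ 2 = (2 : ℝ) ^ (6 + 6) := by
      intro x
      rw [hu'' x, mul_pow]
      have : ((u'' x : ℝ)) ^ 2 = 1 := by exact_mod_cast hsq1' x
      rw [this]; norm_num
    rcases tw_bent_end (by norm_num) f g hf hg hbent with h | h
    · rw [h] at hhi; norm_num at hhi
    · linarith
  push Not at hall
  obtain ⟨x₁, hx₁⟩ := hall
  -- the parity of `u''` is cubic; `Z` has exactly `512` points and is a 9-flat
  have hp : IsDegLeFun 3 (fun x => decide (Odd (u'' x))) :=
    stub_walshTower stub_axParity (6 + 6) 6 3 g u'' hg hu'' (by intro k hk hkn; omega)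
  have hp' : IsDegLeFun (2 + 1) (fun x => decide (Odd (u'' x)) ^^ true) := tb_isDegLeFun_xor_const hp true
  have hfilt : (univ.filter fun x : Fin (6 + 6) → Bool => (decide (Odd (u'' x)) ^^ true) = true) = Z :=
    filter_congr fun x _ => by simp
  have hne : ∃ x, (decide (Odd (u'' x)) ^^ true) = true := ⟨x₁, by simpa using hx₁⟩
  have hRM := bb_rmWeight_holds (6 + 6) 3 (fun x => decide (Odd (u'' x)) ^^ true) hp' hne
  rw [hfilt] at hRM
  have hZge : 512 ≤ #Z := by norm_num at hRM; omega
  have hZcard : #Z = 512 := by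
    have hZle' : #Z ≤ 728 := by exact_mod_cast hZle
    have hsw := sw_cubic_second_weight (m := 6 + 6) _ hp' hne (by rw [hfilt]; norm_num; omega)
    rw [hfilt] at hsw
    norm_num at hsw
    omega
  have hmw := mw_flat_of_minweight 2 (fun x => decide (Odd (u'' x)) ^^ true) hp' (by rw [hfilt, hZcard]; norm_num)
  rw [hfilt] at hmw
  obtain ⟨h0, hadd, hcardV, hcoset⟩ := hmw
  set V₀ := univ.filter (fun a : Fin (6 + 6) → Bool => ∀ x,
    (decide (Odd (u'' (bxor x a))) ^^ true) = (decide (Odd (u'' x)) ^^ true)) with hV₀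
  obtain ⟨xZ, hxZ⟩ : Z.Nonempty := card_pos.1 (by rw [hZcard]; norm_num)
  have hS : Z = V₀.image (bxor xZ) := hcoset xZ (by have h := (hmemZ xZ).1 hxZ; simpa using h)
  rw [hZcard] at hcardV
  have hcardV9 : #V₀ = 2 ^ 9 := by rw [hcardV]; norm_num
  -- budget split: `Σ_Z e² ≥ 512`, so off `Z` at most `216`
  have hZsum_ge : (512 : ℤ) ≤ ∑ x ∈ Z, e x ^ 2 := by
    have h1 : ∑ x ∈ Z, (1 : ℤ) ≤ ∑ x ∈ Z, e x ^ 2 := sum_le_sum fun x hx => hsq1 x hx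
    rw [sum_const, nsmul_eq_mul, mul_one, hZcard] at h1
    exact_mod_cast h1
  have hoff_le : ∑ x ∈ univ.filter (fun x => x ∉ Z), e x ^ 2 ≤ 216 := by linarith
  -- the partner `f` is at level `≥ 6`: type O is excluded by `to18_typeO_gt932_false` (second KT gap), level 5 by `tw15_levelFive_932_false`, for `(g, f)`
  have hΦ' : forrelation g f = forrelation f g := by
    rw [Summit.QuantumAdvantage.QuantumAdvantage.Theorems.SignedCubicForrelationNotPrBPP.Negative.HalfQuad.forrelation_comm]
  obtain ⟨uf, huf⟩ := tw_base (n := 6 + 6) f hf 4 (by norm_num)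
  have hufev : ∀ x, ¬ Odd (uf x) := fun x hx =>
    to18_typeO_gt932_false g f hg hf uf huf ⟨x, hx⟩ (by rw [hΦ']; linarith)
  have huf' : ∀ x, W (fun y => signOf (f y)) x = (2 : ℝ) ^ 5 * (((uf x / 2 : ℤ)) : ℝ) := fun x => by
    rw [tw_level_up f uf huf hufev x]
  have huf'ev : ∀ x, ¬ Odd (uf x / 2) := fun x hx =>
    tw15_levelFive_932_false g f hg hf (fun x => uf x / 2) huf' ⟨x, hx⟩ (by rw [hΦ']; linarith)
  have hwf : ∀ x, W (fun y => signOf (f y)) x = (2 : ℝ) ^ 6 * (((uf x / 2 / 2 : ℤ)) : ℝ) := fun x => by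
    rw [tw_level_up (j := 5) f (fun x => uf x / 2) huf' huf'ev x]
  rcases tw18_off_flat_le216 f g hf hg u'' hu'' V₀ xZ h0 hadd hcardV9 hS hoff_le with
      h8 | ⟨y₁, y₂, hy₁, hy₂, hy₁₂, hoff, hc₁, hc₂, h128⟩ | ⟨y₁, y₂, y₃, hy₁, hy₂, hy₃, hy₁₂, hy₁₃, hy₂₃, hΩC, hΩ54, ⟨ω₄, ω₄', hΩsq⟩, h192⟩
  · /- `8 ∣ e` off `Z`: gen 13's engine with exact accounting at budget `728`, two-sided end (gen 16/18) -/
    exact tw18_levelSix_eight_partner_false735 728 (by norm_num) f g hf hg u'' hu'' (fun x => uf x / 2 / 2) hwf (by linarith) (by linarith)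
      hB_le V₀ xZ h0 hadd hcardV hS h8
  · /- the sparse two-coset exception: `Σ_Z (e² − 1) ≤ 88`, (H3)/(H4) by avoidance, no `|e| ∈ {3,5}` on `Z`, then the two-sided kill -/
    have hDZ : ∑ x ∈ Z, (e x ^ 2 - 1) ≤ 88 := by
      rw [sum_sub_distrib, sum_const, nsmul_eq_mul, mul_one, hZcard]
      push_cast
      linarith
    obtain ⟨H3, H4⟩ := tw15_H34_avoid f g hf hg u'' hu'' V₀ xZ h0 hadd hcardV hS y₁ y₂ hy₁ hy₂ hy₁₂ hoff hc₁ hc₂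
    have hmild := tw15_onZ_no_mild_wild f u'' V₀ xZ h0 hadd hcardV hS (by linarith) H3 H4
    -- on `Z`: `e² = 1`, or `e² ∈ {49, 81}` (the budget `88` affords one point with `|e| = 7` or `|e| = 9`, at most)
    have hZ1 : ∀ x ∈ Z, e x ^ 2 = 1 ∨ e x ^ 2 = 49 ∨ e x ^ 2 = 81 := by
      intro x hx
      rcases hmild x hx with h1 | h49
      · exact Or.inl h1
      · right
        have h2 : e x ^ 2 - 1 ≤ ∑ y ∈ Z, (e y ^ 2 - 1) :=
          single_le_sum (f := fun y => e y ^ 2 - 1) (fun y hy => by linarith [hsq1 y hy]) hx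
        change 49 ≤ e x ^ 2 at h49
        have h81 : e x ^ 2 ≤ 89 := by linarith
        obtain ⟨k, hk⟩ := heodd x hx
        have h9a : e x ≤ 9 := by nlinarith
        have h9b : -9 ≤ e x := by nlinarith
        have h7 : 7 ≤ e x ∨ e x ≤ -7 := by
          by_contra h
          push Not at h
          nlinarith [h.1, h.2]
        have he : e x = 7 ∨ e x = -7 ∨ e x = 9 ∨ e x = -9 := by omega
        rcases he with h | h | h | h <;> rw [h] <;> norm_num
    exact tw18_levelSix_sparse9_false 216 88 (by norm_num) f g hf hg u'' hu'' (fun x => uf x / 2 / 2) hwf (by linarith) (by linarith)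
      V₀ xZ h0 hadd hcardV hS hZ1 hDZ hoff_le H3 H4
  · /- the RIGID exception: `Σ_Z (e² − 1) ≤ 24`, (H3)/(H4) by weighted few-hit transversals, no mild wild point, so `e² = 1` on `Z` -/
    have hDZ : ∑ x ∈ Z, (e x ^ 2 - 1) ≤ 24 := by
      rw [sum_sub_distrib, sum_const, nsmul_eq_mul, mul_one, hZcard]
      push_cast
      linarith
    obtain ⟨H3, H4⟩ := tw18_H34_rigid_w2 f g hf hg u'' hu'' V₀ xZ h0 hadd hcardV hS
      (univ.filter fun ω => ω ∉ Z ∧ ¬ (8 : ℤ) ∣ e ω) y₁ y₂ y₃ hy₁ hy₂ hy₃ hy₁₂ hy₁₃ hy₂₃ hΩC (hΩ54.trans (by norm_num))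
      (fun y hy h8 => mem_filter.2 ⟨mem_univ _, hy, h8⟩) ω₄ ω₄' hΩsq
    have hmild := tw15_onZ_no_mild_wild f u'' V₀ xZ h0 hadd hcardV hS (by linarith) H3 H4
    have hZ1 : ∀ x ∈ Z, e x ^ 2 = 1 ∨ e x ^ 2 = 49 := by
      intro x hx
      rcases hmild x hx with h1 | h49
      · exact Or.inl h1
      · exfalso
        have h2 : e x ^ 2 - 1 ≤ ∑ y ∈ Z, (e y ^ 2 - 1) :=
          single_le_sum (f := fun y => e y ^ 2 - 1) (fun y hy => by linarith [hsq1 y hy]) hx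
        change 49 ≤ e x ^ 2 at h49
        linarith
    exact tw16_levelSix_sparse7_false 216 24 (by norm_num) f g hf hg u'' hu'' (fun x => uf x / 2 / 2) hwf (by linarith) (by linarith)
      V₀ xZ h0 hadd hcardV hS hZ1 hDZ hoff_le H3 H4

/-! ### The value `933/1024` is not attained: the window `[933/1024, 59/64)` is empty -/

/-- **No cubic pair on `6 + 6` bits has `933/1024 ≤ Φ < 59/64`**: by the Ax level of `g` — type O (`to18_typeO_gt932_false`, the second
Kasami–Tokura gap), level 5 (`tw15_levelFive_932_false`), level `≥ 6` (`tw18_levelSix_933_false`). NOT summit progress. [this work] -/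
theorem tw18_window_933_false (f g : (Fin (6 + 6) → Bool) → Bool) (hf : IsDegLeFun 3 f) (hg : IsDegLeFun 3 g)
    (hlo : (933 / 1024 : ℝ) ≤ forrelation f g) (hhi : forrelation f g < 59 / 64) : False := by
  obtain ⟨u, hu⟩ := tw_base (n := 6 + 6) g hg 4 (by norm_num)
  by_cases hO : ∃ x, Odd (u x)
  · exact to18_typeO_gt932_false f g hf hg u hu hO (by linarith)
  push Not at hO
  have hu' : ∀ x, W (fun y => signOf (g y)) x = (2 : ℝ) ^ 5 * (((u x / 2 : ℤ)) : ℝ) := fun x => by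
    rw [tw_level_up g u hu hO x]
  by_cases h5 : ∃ x, Odd (u x / 2)
  · exact tw15_levelFive_932_false f g hf hg (fun x => u x / 2) hu' h5 (by linarith)
  push Not at h5
  have hu'' : ∀ x, W (fun y => signOf (g y)) x = (2 : ℝ) ^ 6 * (((u x / 2 / 2 : ℤ)) : ℝ) := fun x => by
    rw [tw_level_up (j := 5) g (fun x => u x / 2) hu' h5 x]
  exact tw18_levelSix_933_false f g hf hg (fun x => u x / 2 / 2) hu'' hlo hhi

/-- **Closed isolation at `933/1024` on `6 + 6` bits**: `Φ ≥ 933/1024 ⇒ Φ = 1` for cubic pairs (the empty window, then `isolation ≥ 59/64`).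
NOT summit progress. [this work] -/
theorem tw18_isolation_ge_933 (f g : (Fin (6 + 6) → Bool) → Bool) (hf : IsDegLeFun 3 f) (hg : IsDegLeFun 3 g)
    (hΦ : (933 / 1024 : ℝ) ≤ forrelation f g) : forrelation f g = 1 := by
  by_cases h : (59 / 64 : ℝ) ≤ forrelation f g
  · exact tw15_isolation_ge_5964 f g hf hg h
  · exact (tw18_window_933_false f g hf hg hΦ (lt_of_not_ge h)).elim

/-! ### Packaging at the literal type `Fin 12` -/

/-- **`Φ ≥ 933/1024 ⇒ Φ = 1`** for cubic pairs on `Fin 12` (closed isolation eleven rungs below `59/64`): the value `933/1024` is NOT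
attained by cubic pairs on 12 bits. NOT summit progress. [this work] -/
theorem isolation_twelve_ge_933 : ∀ f g : (Fin 12 → Bool) → Bool, IsDegLeFun 3 f → IsDegLeFun 3 g →
    (933 / 1024 : ℝ) ≤ forrelation f g → forrelation f g = 1 :=
  fun f g hf hg h => tw18_isolation_ge_933 f g hf hg h

/-- **`θ₁₂ < 933/1024`**, indeed `θ₁₂ ∈ [57/64, 933/1024)`: the least isolation threshold for cubic pairs on 12 bits is at least the record
`57/64 = 912/1024` (`theta_twelve_bounds`) and STRICTLY below `933/1024` (closed isolation + `fb_theta_lt_of_closed`).  The tree had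
`θ₁₂ < 934/1024` (`theta_twelve_halfopen_934`). NOT summit progress. [this work] -/
theorem theta_twelve_halfopen_933 : ∃ θ₀ : ℝ, 57 / 64 ≤ θ₀ ∧ θ₀ < 933 / 1024 ∧
    IsLeast {θ : ℝ | ∀ f g : (Fin 12 → Bool) → Bool, IsDegLeFun 3 f → IsDegLeFun 3 g →
      θ < forrelation f g → forrelation f g = 1} θ₀ := by
  obtain ⟨θ₀, hθ₀⟩ := theta_exists 12
  obtain ⟨θ, hθlt, hθ⟩ := fb_theta_lt_of_closed (n := 12) (933 / 1024) isolation_twelve_ge_933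
  exact ⟨θ₀, theta_twelve_bounds.2 θ₀ hθ₀.1, lt_of_le_of_lt (hθ₀.2 hθ) hθlt, hθ₀⟩

/-- **No cubic pair on 12 bits has `933/1024 ≤ Φ < 1`.** NOT summit progress. [this work] -/
theorem no_window_twelve_ge_933 : ¬ ∃ f g : (Fin 12 → Bool) → Bool, IsDegLeFun 3 f ∧ IsDegLeFun 3 g ∧
    (933 / 1024 : ℝ) ≤ forrelation f g ∧ forrelation f g < 1 := by
  rintro ⟨f, g, hf, hg, hle, hlt⟩
  have h := isolation_twelve_ge_933 f g hf hg hle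
  linarith

end Summit.QuantumAdvantage.QuantumAdvantage.Theorems.CubicForrelation.NearExactIsExact

end
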